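import Literature.NumberTheory.LFunctions.Lagarias1999.QuadraticLogDeriv
import Literature.NumberTheory.LFunctions.Lagarias1999.Certificate
import Mathlib.NumberTheory.LSeries.Linearity
import Literature.Analysis.SpecialFunctions.DigammaGauss
import HarnessLib

/-!
# Lagarias (1999) — the cosine-free lower bound for `ξ_K'/ξ_K(2) − Re ξ_K'/ξ_K(2+it)`

For an imaginary quadratic field `K` with odd discriminant `−q` the formula of
`Lagarias1999.QuadraticLogDeriv` and (2.14)–(2.17) of [LagariasXiPositivity1999] give, with
`Λ_K(n) = Λ(n)(1 + (n/q)) ≥ 0` (`Lagarias1999.lambdaK`) and `S_K = Σ_n Λ_K(n)/n² = −ζ_K'/ζ_K(2)`,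

`ξ_K'/ξ_K(2) − Re ξ_K'/ξ_K(2+it) ≥ [3/2 − Re 1/(2+it) − Re 1/(1+it)] − [Re ψ(2+it) − Re ψ(2)] − 2 S_K`

(`re_logDeriv_xi_two_sub_ge`: the `log A_K` terms cancel and `|ζ_K'/ζ_K(2+it)| ≤ S_K`), together
with the two elementary series bounds fed to the certificate of `Lagarias1999.Certificate`:
`Re ψ(2+it) − Re ψ(2) = t² Σ_k 1/((k+2)((k+2)²+t²)) ≤ t² (Σ_{k<M} … + 1/(2(M+1)(M+2)))`
(`re_digamma_sub_le`, from the Mittag-Leffler series of `ψ`,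
`Literature.Analysis.SpecialFunctions.Complex.hasSum_one_div_sub_one_div_digamma`) and
`S_K ≤ Σ_{n<N} Λ_K(n)/n² + 2(log(N−1)+1)/(N−1)` (`tsum_lambdaK_div_sq_le`, from `Λ_K(n) ≤ 2 log n`
and the telescoping `log n/n² ≤ g(n−1) − g(n)`, `g(x) = (log x + 1)/x`).
-/

open Complex Filter Topology NumberField NumberField.InfinitePlace
open scoped LSeries.notation ArithmeticFunction.vonMangoldt NumberTheorySymbols
open Literature.NumberTheory.QuadraticFields Literature.NumberTheory.QuadraticFields.Quadratic
open Literature.Analysis.SpecialFunctions.Complex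

namespace Literature.NumberTheory.LFunctions.Lagarias1999

/-! ## The coefficients `Λ_K(n) = Λ(n)(1 + χ(n))` and `|ζ_K'/ζ_K(s)| ≤ Σ Λ_K(n) n^{−Re s}` -/

/-- `Λ_K(n) ≥ 0`. [cite: LagariasXiPositivity1999, (2.14)–(2.15)] -/
theorem lambdaK_nonneg (q n : ℕ) : 0 ≤ lambdaK q n := by
  unfold lambdaK
  refine mul_nonneg ArithmeticFunction.vonMangoldt_nonneg ?_
  rcases jacobiSym.trichotomy (n : ℤ) q with h | h | h <;> rw [h] <;> norm_num

/-- `Λ_K(n) ≤ 2 Λ(n)`. [cite: LagariasXiPositivity1999, (2.14)] -/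
theorem lambdaK_le (q n : ℕ) : lambdaK q n ≤ 2 * Λ n := by
  unfold lambdaK
  have hΛ : 0 ≤ Λ n := ArithmeticFunction.vonMangoldt_nonneg
  rcases jacobiSym.trichotomy (n : ℤ) q with h | h | h <;> rw [h] <;> norm_num <;> nlinarith

/-- `Λ_K(0) = 0`. [folklore] -/
private theorem lambdaK_zero (q : ℕ) : lambdaK q 0 = 0 := by simp [lambdaK]

section char
variable {q : ℕ} [NeZero q]

/-- `Λ(n) + χ(n)Λ(n) = Λ_K(n)` with `χ = (·/q)` as a Dirichlet character.
[cite: LagariasXiPositivity1999, (2.14)] -/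
theorem vonMangoldt_add_twist (n : ℕ) :
    (↗Λ + ↗(jacobiChar q) * ↗Λ) n = (lambdaK q n : ℂ) := by
  simp only [Pi.add_apply, Pi.mul_apply, lambdaK, jacobiChar_natCast]
  push_cast
  ring

/-- The series `Σ Λ_K(n) n^{−s}` converges absolutely for `Re s > 1`. [folklore] -/
private theorem LSeriesSummable_lambdaK {s : ℂ} (hs : 1 < s.re) :
    LSeriesSummable (fun n => (lambdaK q n : ℂ)) s := by
  have h := LSeriesSummable.add (ArithmeticFunction.LSeriesSummable_vonMangoldt hs)
    (DirichletCharacter.LSeriesSummable_twist_vonMangoldt (jacobiChar q) hs)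
  exact (LSeriesSummable_congr s fun {n} _ => vonMangoldt_add_twist (q := q) n).mp h

/-- `−ζ'/ζ(s) − L'/L(s, χ) = Σ_n Λ_K(n) n^{−s}` for `Re s > 1`, i.e. `−ζ_K'/ζ_K = Σ Λ_K(n) n^{−s}`.
[cite: LagariasXiPositivity1999, (2.14)] -/
theorem LSeries_lambdaK_eq {s : ℂ} (hs : 1 < s.re) :
    L ↗Λ s + L (↗(jacobiChar q) * ↗Λ) s = LSeries (fun n => (lambdaK q n : ℂ)) s := by
  rw [← LSeries_add (ArithmeticFunction.LSeriesSummable_vonMangoldt hs)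
    (DirichletCharacter.LSeriesSummable_twist_vonMangoldt (jacobiChar q) hs)]
  exact LSeries_congr (fun {n} _ => vonMangoldt_add_twist (q := q) n) s

/-- `Σ_n Λ_K(n) n^{−σ}` converges for real `σ > 1`. [folklore] -/
private theorem summable_lambdaK_div_rpow {σ : ℝ} (hσ : 1 < σ) :
    Summable (fun n : ℕ => lambdaK q n / (n : ℝ) ^ σ) := by
  have h := LSeriesSummable_lambdaK (q := q) (s := (σ : ℂ)) (by simpa using hσ)
  rw [LSeriesSummable, ← summable_norm_iff] at h
  refine h.congr fun n => ?_
  rw [LSeries.norm_term_eq]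
  split_ifs with hn
  · simp [hn, lambdaK_zero]
  · rw [Complex.norm_real, Real.norm_of_nonneg (lambdaK_nonneg q n), Complex.ofReal_re]

/-- (2.15) in norm form: `|Σ_n Λ_K(n) n^{−s}| ≤ Σ_n Λ_K(n) n^{−Re s}` for `Re s > 1` (non-negativity
of `Λ_K`). [cite: LagariasXiPositivity1999, (2.15)] -/
theorem norm_LSeries_lambdaK_le {s : ℂ} (hs : 1 < s.re) :
    ‖LSeries (fun n => (lambdaK q n : ℂ)) s‖ ≤ ∑' n : ℕ, lambdaK q n / (n : ℝ) ^ s.re := by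
  have h := LSeriesSummable_lambdaK (q := q) hs
  have hn : Summable fun n => ‖LSeries.term (fun n => (lambdaK q n : ℂ)) s n‖ := by
    rw [summable_norm_iff]; exact h
  refine (norm_tsum_le_tsum_norm hn).trans (le_of_eq (tsum_congr fun n => ?_))
  rw [LSeries.norm_term_eq]
  split_ifs with hn0
  · simp [hn0, lambdaK_zero]
  · rw [Complex.norm_real, Real.norm_of_nonneg (lambdaK_nonneg q n)]

end char

/-! ## A tail bound for `Σ_{n ≥ N} Λ_K(n)/n²` -/

/-- For `n ≥ 4`: `log n / n² ≤ g(n−1) − g(n)` with `g(x) = (log x + 1)/x` (so the tail telescopes).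
[folklore] -/
private theorem log_div_sq_le_sub {n : ℕ} (hn : 4 ≤ n) :
    Real.log n / (n : ℝ) ^ 2 ≤
      (Real.log ((n : ℝ) - 1) + 1) / ((n : ℝ) - 1) - (Real.log n + 1) / n := by
  have hn4 : (4 : ℝ) ≤ n := by exact_mod_cast hn
  have hx0 : 0 < (n : ℝ) := by linarith
  have hy0 : 0 < (n : ℝ) - 1 := by linarith
  -- `log((n-1)/n) ≥ 1 − n/(n−1) = −1/(n−1)`
  have hlog : -(1 / ((n : ℝ) - 1)) ≤ Real.log ((n : ℝ) - 1) - Real.log n := by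
    have h := Real.one_sub_inv_le_log_of_pos (div_pos hy0 hx0)
    rw [Real.log_div hy0.ne' hx0.ne', inv_div] at h
    have : 1 - (n : ℝ) / ((n : ℝ) - 1) = -(1 / ((n : ℝ) - 1)) := by field_simp; ring
    linarith
  -- `log n ≥ log 4 = 2 log 2 ≥ 4/3 ≥ 1 + 1/(n−1)`
  have hlx : 1 + 1 / ((n : ℝ) - 1) ≤ Real.log n := by
    have h2 := Real.log_two_gt_d9
    have h4 : Real.log 4 = 2 * Real.log 2 := by
      rw [show (4 : ℝ) = 2 ^ 2 by norm_num, Real.log_pow]; norm_num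
    have hmono := Real.log_le_log (by norm_num) hn4
    have : 1 / ((n : ℝ) - 1) ≤ 1 / 3 := by
      rw [div_le_div_iff₀ hy0 (by norm_num)]; linarith
    linarith
  have hlx' : (n : ℝ) ≤ Real.log n * ((n : ℝ) - 1) := by
    have := mul_le_mul_of_nonneg_right hlx hy0.le
    rw [add_mul, one_mul, one_div, inv_mul_cancel₀ hy0.ne'] at this
    linarith
  have key : 0 ≤ (n : ℝ) ^ 2 * (Real.log ((n : ℝ) - 1) - Real.log n) + n + Real.log n := by
    have h1 : -((n : ℝ) ^ 2 / ((n : ℝ) - 1)) ≤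
        (n : ℝ) ^ 2 * (Real.log ((n : ℝ) - 1) - Real.log n) := by
      have := mul_le_mul_of_nonneg_left hlog (sq_nonneg (n : ℝ))
      rw [mul_neg, mul_one_div] at this
      exact this
    have h2 : (n : ℝ) ^ 2 / ((n : ℝ) - 1) ≤ (n : ℝ) + Real.log n := by
      rw [div_le_iff₀ hy0]; nlinarith
    linarith
  have hid : (Real.log ((n : ℝ) - 1) + 1) / ((n : ℝ) - 1) - (Real.log n + 1) / n
      - Real.log n / (n : ℝ) ^ 2 =
      ((n : ℝ) ^ 2 * (Real.log ((n : ℝ) - 1) - Real.log n) + n + Real.log n) /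
        ((n : ℝ) ^ 2 * ((n : ℝ) - 1)) := by
    field_simp
    ring
  rw [← sub_nonneg, hid]
  positivity

/-- Telescoped tail: `Σ_{k<m} log(k+N)/(k+N)² ≤ (log(N−1) + 1)/(N−1)` for `N ≥ 4`. [folklore] -/
private theorem sum_log_div_sq_tail_le {N : ℕ} (hN : 4 ≤ N) (m : ℕ) :
    ∑ k ∈ Finset.range m, Real.log ((k : ℝ) + N) / ((k : ℝ) + N) ^ 2 ≤
      (Real.log ((N : ℝ) - 1) + 1) / ((N : ℝ) - 1) := by
  have hN4 : (4 : ℝ) ≤ N := by exact_mod_cast hN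
  -- `G m = g(m + N − 1)`, `g(x) = (log x + 1)/x ≥ 0` for `x ≥ 1`
  have hg : 0 ≤ (Real.log ((m : ℝ) + N - 1) + 1) / ((m : ℝ) + N - 1) := by
    have hm := (Nat.cast_nonneg m : (0 : ℝ) ≤ m)
    have h1 : (1 : ℝ) ≤ (m : ℝ) + N - 1 := by linarith
    exact div_nonneg (by linarith [Real.log_nonneg h1]) (by linarith)
  suffices h : ∀ m : ℕ, ∑ k ∈ Finset.range m, Real.log ((k : ℝ) + N) / ((k : ℝ) + N) ^ 2 ≤
      (Real.log ((N : ℝ) - 1) + 1) / ((N : ℝ) - 1) -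
        (Real.log ((m : ℝ) + N - 1) + 1) / ((m : ℝ) + N - 1) by
    exact (h m).trans (sub_le_self _ hg)
  intro m
  induction m with
  | zero => simp
  | succ m ih =>
    rw [Finset.sum_range_succ]
    have hstep := log_div_sq_le_sub (n := m + N) (by omega)
    push_cast at hstep
    have e : (((m + 1 : ℕ) : ℝ) + N - 1) = (m : ℝ) + N := by push_cast; ring
    rw [e]
    linarith

section tail
variable {q : ℕ} [NeZero q]

/-- `Σ_n Λ_K(n)/n²` converges. [folklore] -/
private theorem summable_lambdaK_div_sq : Summable (fun n : ℕ => lambdaK q n / (n : ℝ) ^ 2) := by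
  have := summable_lambdaK_div_rpow (q := q) (σ := 2) (by norm_num)
  simpa [Real.rpow_two] using this

/-- **Tail bound** for the Dirichlet series (2.15) of `−ζ_K'/ζ_K` at `σ = 2`:
`Σ_n Λ_K(n)/n² ≤ Σ_{n<N} Λ_K(n)/n² + 2 (log(N−1) + 1)/(N−1)` for `N ≥ 4`
(`Λ_K(n) ≤ 2 log n` and the telescoping `log n/n² ≤ g(n−1) − g(n)`, `g(x) = (log x + 1)/x`).
[cite: LagariasXiPositivity1999, (2.14)–(2.15)] -/
theorem tsum_lambdaK_div_sq_le {N : ℕ} (hN : 4 ≤ N) :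
    ∑' n : ℕ, lambdaK q n / (n : ℝ) ^ 2 ≤
      ∑ n ∈ Finset.range N, lambdaK q n / (n : ℝ) ^ 2 +
        2 * ((Real.log ((N : ℝ) - 1) + 1) / ((N : ℝ) - 1)) := by
  have hs := summable_lambdaK_div_sq (q := q)
  rw [← hs.sum_add_tsum_nat_add N]
  gcongr
  refine Real.tsum_le_of_sum_range_le (fun k => div_nonneg (lambdaK_nonneg q _) (sq_nonneg _))
    fun m => ?_
  have hle : ∀ k : ℕ, lambdaK q (k + N) / (((k + N : ℕ) : ℝ)) ^ 2 ≤
      2 * (Real.log ((k : ℝ) + N) / ((k : ℝ) + N) ^ 2) := fun k => by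
    have h1 := (lambdaK_le q (k + N)).trans
      (mul_le_mul_of_nonneg_left ArithmeticFunction.vonMangoldt_le_log (by norm_num))
    push_cast at h1 ⊢
    rw [mul_div_assoc']
    exact div_le_div_of_nonneg_right h1 (sq_nonneg _)
  calc ∑ k ∈ Finset.range m, lambdaK q (k + N) / (((k + N : ℕ) : ℝ)) ^ 2
      ≤ ∑ k ∈ Finset.range m, 2 * (Real.log ((k : ℝ) + N) / ((k : ℝ) + N) ^ 2) :=
        Finset.sum_le_sum fun k _ => hle k
    _ = 2 * ∑ k ∈ Finset.range m, Real.log ((k : ℝ) + N) / ((k : ℝ) + N) ^ 2 := by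
        rw [Finset.mul_sum]
    _ ≤ 2 * ((Real.log ((N : ℝ) - 1) + 1) / ((N : ℝ) - 1)) :=
        mul_le_mul_of_nonneg_left (sum_log_div_sq_tail_le hN m) (by norm_num)

end tail

/-! ## `Re ψ(2) − Re ψ(2+it)` as a series -/

/-- [folklore] -/
private theorem psiDropTerm_nonneg (t : ℝ) (k : ℕ) : 0 ≤ psiDropTerm t k := by
  unfold psiDropTerm; positivity

/-- From the Mittag-Leffler expansion (2.16) of `ψ`:
`Re ψ(2+it) − Re ψ(2) = t² Σ_{k≥0} 1/((k+2)((k+2)²+t²))`. [cite: LagariasXiPositivity1999, (2.16)–(2.17)] -/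
theorem hasSum_re_digamma_sub (t : ℝ) :
    HasSum (fun k : ℕ => t ^ 2 * psiDropTerm t k)
      ((digamma (2 + t * I)).re - (digamma 2).re) := by
  have h2 := hasSum_one_div_sub_one_div_digamma (w := (2 : ℂ)) (by norm_num)
  have hs := hasSum_one_div_sub_one_div_digamma (w := 2 + t * I) (by simp)
  have hre := Complex.hasSum_re (hs.sub h2)
  have hval : ((digamma (2 + t * I) + Real.eulerMascheroniConstant) -
      (digamma 2 + Real.eulerMascheroniConstant)).re =
      (digamma (2 + t * I)).re - (digamma 2).re := by
    simp
  rw [hval] at hre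
  refine hre.congr_fun fun k => ?_
  -- the summand is `1/(2+k) − 1/(2+it+k)`, of real part `1/(k+2) − (k+2)/((k+2)²+t²)`
  have hring : (1 / ((k : ℂ) + 1) - 1 / (2 + t * I + k) - (1 / ((k : ℂ) + 1) - 1 / (2 + k))) =
      1 / (2 + (k : ℂ)) - 1 / (2 + t * I + k) := by ring
  have hz : (2 : ℂ) + t * I + k = ⟨(k : ℝ) + 2, t⟩ := by
    apply Complex.ext <;> simp [add_comm]
  have hnsq : Complex.normSq ⟨(k : ℝ) + 2, t⟩ = ((k : ℝ) + 2) ^ 2 + t ^ 2 := by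
    rw [Complex.normSq_mk]; ring
  have h1 : (1 / (2 + (k : ℂ))).re = 1 / ((k : ℝ) + 2) := by
    rw [show (2 + (k : ℂ)) = (((k : ℝ) + 2 : ℝ) : ℂ) by push_cast; ring, ← Complex.ofReal_one,
      ← Complex.ofReal_div, Complex.ofReal_re]
  have h2 : (1 / (2 + t * I + (k : ℂ))).re = ((k : ℝ) + 2) / (((k : ℝ) + 2) ^ 2 + t ^ 2) := by
    rw [hz, one_div, Complex.inv_re, hnsq]
  rw [hring, Complex.sub_re, h1, h2]
  unfold psiDropTerm
  have hpos : 0 < ((k : ℝ) + 2) := by positivity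
  have hD : 0 < ((k : ℝ) + 2) ^ 2 + t ^ 2 := by positivity
  field_simp
  ring

/-- `1/((j+2)((j+2)²+t²)) ≤ ½ (1/((j+1)(j+2)) − 1/((j+2)(j+3)))` (`= 1/((j+1)(j+2)(j+3))`). [folklore] -/
private theorem psiDropTerm_le (t : ℝ) (j : ℕ) :
    psiDropTerm t j ≤
      1 / 2 * (1 / (((j : ℝ) + 1) * ((j : ℝ) + 2)) - 1 / (((j : ℝ) + 2) * ((j : ℝ) + 3))) := by
  have hj := (Nat.cast_nonneg j : (0 : ℝ) ≤ j)
  have hrhs : 1 / 2 * (1 / (((j : ℝ) + 1) * ((j : ℝ) + 2)) - 1 / (((j : ℝ) + 2) * ((j : ℝ) + 3)))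
      = 1 / (((j : ℝ) + 1) * ((j : ℝ) + 2) * ((j : ℝ) + 3)) := by
    field_simp; ring
  rw [hrhs]
  unfold psiDropTerm
  apply one_div_le_one_div_of_le (by positivity)
  nlinarith [sq_nonneg t]

/-- `Σ_{k<n} 1/((k+M+2)((k+M+2)²+t²)) ≤ 1/(2(M+1)(M+2))`. [folklore] -/
private theorem sum_psiDropTerm_tail_le (t : ℝ) (M n : ℕ) :
    ∑ k ∈ Finset.range n, psiDropTerm t (k + M) ≤ 1 / (2 * (((M : ℝ) + 1) * ((M : ℝ) + 2))) := by
  suffices h : ∀ n : ℕ, ∑ k ∈ Finset.range n, psiDropTerm t (k + M) ≤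
      1 / 2 * (1 / (((M : ℝ) + 1) * ((M : ℝ) + 2)) -
        1 / (((n : ℝ) + M + 1) * ((n : ℝ) + M + 2))) by
    refine (h n).trans ?_
    have : 0 ≤ 1 / (((n : ℝ) + M + 1) * ((n : ℝ) + M + 2)) := by positivity
    have e : 1 / (2 * (((M : ℝ) + 1) * ((M : ℝ) + 2))) = 1 / 2 * (1 / (((M : ℝ) + 1) * ((M : ℝ) + 2))) := by
      field_simp
    rw [e]; linarith
  intro n
  induction n with
  | zero => simp
  | succ n ih =>
    rw [Finset.sum_range_succ]
    have hstep := psiDropTerm_le t (n + M)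
    push_cast at hstep ⊢
    rw [show ((n : ℝ) + 1 + M + 1) = (n : ℝ) + M + 2 by ring,
      show ((n : ℝ) + 1 + M + 2) = (n : ℝ) + M + 3 by ring]
    linarith [hstep, ih]

/-- **Upper bound for the digamma drop** (Mittag-Leffler expansion (2.16) of `ψ`, tail telescoped):
for every `M`, `Re ψ(2+it) − Re ψ(2) ≤ t² (Σ_{k<M} 1/((k+2)((k+2)²+t²)) + 1/(2(M+1)(M+2)))`.
[cite: LagariasXiPositivity1999, (2.16)–(2.17)] -/
theorem re_digamma_sub_le (t : ℝ) (M : ℕ) :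
    (digamma (2 + t * I)).re - (digamma 2).re ≤
      t ^ 2 * (∑ k ∈ Finset.range M, psiDropTerm t k + 1 / (2 * (((M : ℝ) + 1) * ((M : ℝ) + 2)))) := by
  have h := hasSum_re_digamma_sub t
  have hs := h.summable
  rw [← h.tsum_eq, ← hs.sum_add_tsum_nat_add M, ← Finset.mul_sum, mul_add]
  gcongr
  rw [tsum_mul_left]
  refine mul_le_mul_of_nonneg_left ?_ (sq_nonneg t)
  exact Real.tsum_le_of_sum_range_le (fun k => psiDropTerm_nonneg t _)
    (sum_psiDropTerm_tail_le t M)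

/-! ## The main inequality for `Re ξ_K'/ξ_K(2) − Re ξ_K'/ξ_K(2+it)` -/

section main
variable {K : Type*} [Field K] [NumberField K]

/-- **`Re ξ_K'/ξ_K(2) − Re ξ_K'/ξ_K(2+it) ≥ A(t) − [Re ψ(2+it) − Re ψ(2)] − 2 S_K`** for an imaginary
quadratic field `K` with odd discriminant, where
`A(t) = 3/2 − Re 1/(2+it) − Re 1/(1+it)` and `S_K = Σ_n Λ_K(n)/n² = −ζ_K'/ζ_K(2)`
(the `log A_K` terms cancel; `|ζ_K'/ζ_K(2+it)| ≤ S_K` by (2.15)).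
[cite: LagariasXiPositivity1999, (2.13)–(2.17)] -/
theorem re_logDeriv_xi_two_sub_ge [NeZero (discr K).natAbs] (h2 : Module.finrank ℚ K = 2)
    (hd : discr K < 0) (hodd : Odd (discr K)) (t : ℝ) :
    (3 / 2 - (1 / (2 + t * I : ℂ)).re - (1 / (1 + t * I : ℂ)).re)
      - ((digamma (2 + t * I)).re - (digamma 2).re)
      - 2 * ∑' n : ℕ, lambdaK (discr K).natAbs n / (n : ℝ) ^ 2 ≤
    (logDeriv (xi K) 2).re - (logDeriv (xi K) (2 + t * I)).re := by
  set q := (discr K).natAbs with hq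
  set S := ∑' n : ℕ, lambdaK q n / (n : ℝ) ^ 2 with hS
  have hs2 : 1 < (2 : ℂ).re := by norm_num
  have hst : 1 < (2 + t * I : ℂ).re := by simp
  rw [logDeriv_xi_eq h2 hd hodd hs2, logDeriv_xi_eq h2 hd hodd hst]
  have hL2 : L ↗Λ (2 : ℂ) + L (↗(jacobiChar q) * ↗Λ) 2 = LSeries (fun n => (lambdaK q n : ℂ)) 2 :=
    LSeries_lambdaK_eq hs2
  have hLs : L ↗Λ (2 + t * I) + L (↗(jacobiChar q) * ↗Λ) (2 + t * I) =
      LSeries (fun n => (lambdaK q n : ℂ)) (2 + t * I) := LSeries_lambdaK_eq hst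
  have hb2 : ‖LSeries (fun n => (lambdaK q n : ℂ)) 2‖ ≤ S := by
    have := norm_LSeries_lambdaK_le (q := q) hs2
    simpa [Real.rpow_two] using this
  have hbs : ‖LSeries (fun n => (lambdaK q n : ℂ)) (2 + t * I)‖ ≤ S := by
    have := norm_LSeries_lambdaK_le (q := q) hst
    simpa [Real.rpow_two] using this
  have hre2 := Complex.re_le_norm (LSeries (fun n => (lambdaK q n : ℂ)) 2)
  have hres := Complex.abs_re_le_norm (LSeries (fun n => (lambdaK q n : ℂ)) (2 + t * I))
  rw [abs_le] at hres
  -- real parts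
  have e2 : (1 / (2 : ℂ) + 1 / (2 - 1) + (Real.log (lagariasA K) : ℂ) + digamma 2 - L ↗Λ 2 -
      L (↗(jacobiChar q) * ↗Λ) 2).re =
      3 / 2 + Real.log (lagariasA K) + (digamma 2).re - (LSeries (fun n => (lambdaK q n : ℂ)) 2).re := by
    rw [show (1 / (2 : ℂ) + 1 / (2 - 1) + (Real.log (lagariasA K) : ℂ) + digamma 2 - L ↗Λ 2 -
      L (↗(jacobiChar q) * ↗Λ) 2) = 1 / 2 + 1 / (2 - 1) + (Real.log (lagariasA K) : ℂ) + digamma 2 -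
      (L ↗Λ 2 + L (↗(jacobiChar q) * ↗Λ) 2) by ring, hL2]
    simp only [Complex.sub_re, Complex.add_re, Complex.ofReal_re]
    norm_num
  have es : (1 / (2 + t * I : ℂ) + 1 / (2 + t * I - 1) + (Real.log (lagariasA K) : ℂ) +
      digamma (2 + t * I) - L ↗Λ (2 + t * I) - L (↗(jacobiChar q) * ↗Λ) (2 + t * I)).re =
      (1 / (2 + t * I : ℂ)).re + (1 / (1 + t * I : ℂ)).re + Real.log (lagariasA K) +
        (digamma (2 + t * I)).re - (LSeries (fun n => (lambdaK q n : ℂ)) (2 + t * I)).re := by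
    rw [show (1 / (2 + t * I : ℂ) + 1 / (2 + t * I - 1) + (Real.log (lagariasA K) : ℂ) +
      digamma (2 + t * I) - L ↗Λ (2 + t * I) - L (↗(jacobiChar q) * ↗Λ) (2 + t * I)) =
      1 / (2 + t * I) + 1 / (2 + t * I - 1) + (Real.log (lagariasA K) : ℂ) + digamma (2 + t * I) -
      (L ↗Λ (2 + t * I) + L (↗(jacobiChar q) * ↗Λ) (2 + t * I)) by ring, hLs,
      show (2 + t * I - 1 : ℂ) = 1 + t * I by ring]
    simp only [Complex.sub_re, Complex.add_re, Complex.ofReal_re]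
  rw [e2, es]
  linarith

end main

end Literature.NumberTheory.LFunctions.Lagarias1999
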